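import Summits.Ventures.CertifiedArithmetic.LowPrec.GemmPrecRounding

/-!
# Round-to-nearest-even on the grid `2^-G` for an arbitrary precision, in integers

HONEST FRAMING (venture CertifiedArithmetic / cell `pub-lowprec`, seat gemm, gen 12 → 13): certified
error envelopes and provably optimal rounding/accumulation schemes for low-precision formats under
stated cost models; every table by two implementations; no hardware or vendor claims.

`GemmPrecRounding.lean` bridges `roundNE φ` to the integer rounding `rneZ` on the QUARTER grid
(E2M1 × E2M1 products are quarter-integers).  The FP6 and mixed FP6/FP4 product alphabets of paper
`gemm.tex` Theorems t:thetap6 / t:thetapmix live on finer dyadic grids (`2^-4` for E2M3×E2M1,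
`2^-5` for E3M2×E2M1, `2^-6` for E2M3², `2^-7` for E3M2×E2M3, `2^-8` for E3M2²).  This file is the
same bridge for an ARBITRARY grid `2^-G` inside the exponent range (`qexp φ ≤ -G`):
`toRat_roundNE_grid_prec` proves `fl_φ(K/2^G) = rneZ (manBits φ) K / 2^G` whenever
`|K|/2^G ≤ maxRat φ`, and the step / gain / deficit of `GemmThetaCertificate.lean` follow in grid
units (`flStep_grid_prec`, `gainOf_grid_prec`, `deficitOf_grid_prec`).  It is step (S1) of the
soundness chain for the letter-dependent θ-certificates (`GemmThetaLawGenDefs.lean`); the proofs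
are those of the quarter file with `4 ↦ 2^G`.  Nothing here is specific to gemm.
-/

namespace Literature.ComputerArithmetic.FloatingPoint

namespace MiniFloat

open Format

variable {φ : Format}

/-! ### The bridge to `roundNE φ` on the grid `2^-G` -/

/-- Integers below `2^(m+1)` in magnitude, read in units `2^-G`, are values of `φ` (when the grid
lies in `φ`'s exponent range and the value is in range). [folklore] -/
theorem exists_toRat_eq_grid_prec {G : ℕ} (hq : φ.qexp ≤ -(G : ℤ)) {K : ℤ}
    (hK : K.natAbs < 2 ^ (φ.manBits + 1)) (hR : ((K.natAbs : ℕ) : ℚ) / 2 ^ G ≤ φ.maxRat) :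
    ∃ y : MiniFloat φ, y.toRat = (K : ℚ) / 2 ^ G := by
  refine exists_toRat_eq_of_isFloat ⟨K, -(G : ℤ), ?_, hq, ?_⟩ ?_
  · rw [← Int.natCast_natAbs]; exact_mod_cast hK
  · rw [zpow_neg, zpow_natCast]; ring
  · rwa [abs_div, abs_of_pos (by positivity : (0 : ℚ) < 2 ^ G), ← Int.cast_abs,
      ← Nat.cast_natAbs]

/-- THE BRIDGE FOR EVERY PRECISION AND EVERY DYADIC GRID: `fl_φ(K/2^G) = rneZ (manBits φ) K / 2^G`
whenever `qexp φ ≤ -G` and `|K|/2^G ≤ maxRat φ` — exact below `2^(m+1)`, the pattern rounding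
above (`Format.rneGrid_of_pattern`); no saturation occurs. [folklore] -/
theorem toRat_roundNE_grid_prec {G : ℕ} (hq : φ.qexp ≤ -(G : ℤ)) (K : ℤ)
    (hR : ((K.natAbs : ℕ) : ℚ) / 2 ^ G ≤ φ.maxRat) :
    (roundNE φ ((K : ℚ) / 2 ^ G)).toRat = (rneZ φ.manBits K : ℚ) / 2 ^ G := by
  have hGpos : (0 : ℚ) < 2 ^ G := by positivity
  have habs : |(K : ℚ) / 2 ^ G| = (K.natAbs : ℚ) / 2 ^ G := by
    rw [abs_div, abs_of_pos hGpos, Nat.cast_natAbs, Int.cast_abs]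
  have hsgn : (K : ℚ) / 2 ^ G < 0 ↔ K < 0 := by
    rw [div_lt_iff₀ hGpos, zero_mul]; norm_cast
  have hmax : |(K : ℚ) / 2 ^ G| ≤ φ.maxRat := by rw [habs]; exact hR
  by_cases hn : K.natAbs < 2 ^ (φ.manBits + 1)
  · -- exact branch
    rw [toRat_roundNE_of_exists (exists_toRat_eq_grid_prec hq hn hR)]
    unfold rneZ rneSigMag
    rw [if_pos hn]
    have : (if K < 0 then -((K.natAbs : ℕ) : ℤ) else ((K.natAbs : ℕ) : ℤ)) = K := by
      split_ifs with h <;> omega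
    rw [this]
  · -- pattern branch
    have hn0 : K.natAbs ≠ 0 := by
      intro h; rw [h] at hn; exact hn (by positivity)
    have hA : 2 ^ Nat.log2 K.natAbs ≤ K.natAbs := Nat.log2_self_le hn0
    have hB : K.natAbs < 2 ^ (Nat.log2 K.natAbs + 1) := Nat.lt_log2_self
    have hm : φ.manBits + 1 ≤ Nat.log2 K.natAbs := by
      by_contra hc
      have := Nat.pow_le_pow_right (by norm_num : 0 < 2)
        (show Nat.log2 K.natAbs + 1 ≤ φ.manBits + 1 by omega)
      omega
    set k := Nat.log2 K.natAbs - φ.manBits with hk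
    have hlk : Nat.log2 K.natAbs = φ.manBits + k := by omega
    have hlo : 2 ^ (φ.manBits + k) ≤ K.natAbs := by rw [← hlk]; exact hA
    have hhi : K.natAbs < 2 ^ (φ.manBits + k + 1) := by rw [← hlk]; exact hB
    obtain ⟨g, hg⟩ := Int.eq_ofNat_of_zero_le (show (0 : ℤ) ≤ -(G : ℤ) - φ.qexp by omega)
    have hqG : (1 : ℚ) / 2 ^ G = 2 ^ g * φ.quantum := by
      unfold Format.quantum
      rw [← zpow_natCast (2 : ℚ) g, ← zpow_add₀ (by norm_num : (2 : ℚ) ≠ 0),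
        show (g : ℤ) + φ.qexp = -(G : ℤ) by omega, zpow_neg, zpow_natCast, one_div]
    have hx : |(K : ℚ) / 2 ^ G| = (K.natAbs : ℚ) * 2 ^ (g + k) / 2 ^ k * φ.quantum := by
      rw [habs, pow_add, div_eq_mul_one_div (K.natAbs : ℚ) (2 ^ G), hqG]; field_simp
    have hgrid := Format.rneGrid_of_pattern hlo hhi (pattern_le_maxScaled hx hmax)
    rw [rneInt_natCast_div_two_pow, Int.cast_natCast] at hgrid
    rw [toRat_roundNE, scaledInput_of_pattern hx]
    unfold rneZ
    rw [rneSigMag_of_binade hlo hhi]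
    simp only [hsgn]
    split_ifs with hneg
    · rw [neg_mul, hgrid]; push_cast
      rw [pow_add, div_eq_mul_one_div _ ((2 : ℚ) ^ G), hqG]; ring
    · rw [hgrid]; push_cast
      rw [pow_add, div_eq_mul_one_div _ ((2 : ℚ) ^ G), hqG]; ring

/-- A rounded grid value is a value of `φ`. [folklore] -/
theorem exists_toRat_eq_rneZ_grid {G : ℕ} (hq : φ.qexp ≤ -(G : ℤ)) (K : ℤ)
    (hR : ((K.natAbs : ℕ) : ℚ) / 2 ^ G ≤ φ.maxRat) :
    ∃ y : MiniFloat φ, y.toRat = (rneZ φ.manBits K : ℚ) / 2 ^ G :=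
  ⟨_, toRat_roundNE_grid_prec hq K hR⟩

/-- The quarter bridge of `GemmPrecRounding` is the case `G = 2`. [cell, consistency check] -/
theorem toRat_roundNE_grid_prec_two (hq : φ.qexp ≤ -2) (K : ℤ)
    (hR : ((K.natAbs : ℕ) : ℚ) / 4 ≤ φ.maxRat) :
    (roundNE φ ((K : ℚ) / 2 ^ (2 : ℕ))).toRat = (rneZ φ.manBits K : ℚ) / 4 := by
  have h4 : ((2 : ℚ) ^ (2 : ℕ)) = 4 := by norm_num
  rw [toRat_roundNE_grid_prec (G := 2) (by simpa using hq) K (by rw [h4]; exact hR), h4]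

/-! ### Range bookkeeping: `|K| < 2^(m+E+G)` and `2^(m+E) ≤ maxRat` -/

/-- A size hypothesis `2^(m+E) ≤ maxRat` implies the range hypothesis of the bridge for every
`|K| < 2^(m+E+G)`. [folklore] -/
theorem grid_le_maxRat_of_lt {G E : ℕ} (hRange : (2 : ℚ) ^ (φ.manBits + E) ≤ φ.maxRat) {K : ℤ}
    (hK : K.natAbs < 2 ^ (φ.manBits + E + G)) : ((K.natAbs : ℕ) : ℚ) / 2 ^ G ≤ φ.maxRat := by
  have h : ((K.natAbs : ℕ) : ℚ) < 2 ^ (φ.manBits + E + G) := by exact_mod_cast hK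
  rw [div_le_iff₀ (by positivity : (0 : ℚ) < 2 ^ G)]
  have : (2 : ℚ) ^ (φ.manBits + E + G) = 2 ^ (φ.manBits + E) * 2 ^ G := by ring
  have hG : (0 : ℚ) < 2 ^ G := by positivity
  nlinarith

/-! ### One step, gain and deficit in grid units, every precision -/

/-- `fl_φ(V/2^G + Q/2^G) = rneZ m (V + Q)/2^G`. [cell; the bridge] -/
theorem flStep_grid_prec {G : ℕ} (hq : φ.qexp ≤ -(G : ℤ)) {V Q : ℤ}
    (h : (((V + Q).natAbs : ℕ) : ℚ) / 2 ^ G ≤ φ.maxRat) :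
    flStep φ ((V : ℚ) / 2 ^ G) ((Q : ℚ) / 2 ^ G) = (rneZ φ.manBits (V + Q) : ℚ) / 2 ^ G := by
  unfold flStep
  rw [show (V : ℚ) / 2 ^ G + (Q : ℚ) / 2 ^ G = ((V + Q : ℤ) : ℚ) / 2 ^ G by push_cast; ring]
  exact toRat_roundNE_grid_prec hq (V + Q) h

/-- The gain in grid units. [cell] -/
theorem gainOf_grid_prec {G : ℕ} (hq : φ.qexp ≤ -(G : ℤ)) {V Q : ℤ}
    (h : (((V + Q).natAbs : ℕ) : ℚ) / 2 ^ G ≤ φ.maxRat) :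
    gainOf φ ((V : ℚ) / 2 ^ G) ((Q : ℚ) / 2 ^ G)
      = ((rneZ φ.manBits (V + Q) - V - Q : ℤ) : ℚ) / 2 ^ G := by
  unfold gainOf; rw [flStep_grid_prec hq h]; push_cast; ring

/-- The deficit in grid units. [cell] -/
theorem deficitOf_grid_prec {G : ℕ} (hq : φ.qexp ≤ -(G : ℤ)) {V Q : ℤ}
    (h : (((V + Q).natAbs : ℕ) : ℚ) / 2 ^ G ≤ φ.maxRat) :
    deficitOf φ ((V : ℚ) / 2 ^ G) ((Q : ℚ) / 2 ^ G)
      = (((Q.natAbs : ℤ) - (rneZ φ.manBits (V + Q) - V - Q) : ℤ) : ℚ) / 2 ^ G := by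
  unfold deficitOf
  rw [gainOf_grid_prec hq h, abs_div, abs_of_pos (by positivity : (0 : ℚ) < 2 ^ G),
    ← Int.cast_abs, ← Int.natCast_natAbs]
  push_cast; ring

/-- Sanity values on the grid `2^-4` of E2M3×E2M1 at `m = 9` (`p = 10`, spacing `2` on
`[1024, 2048)` in grid units): `1025 ↦ 1024`, `1027 ↦ 1028` (tie to even), `1029 ↦ 1028`;
and `rneZ 12 8193 = 8192` (E3M2×E2M1's `p = 13`). [cell, kernel-checked] -/
theorem rneZ_grid_values :
    rneZ 9 1025 = 1024 ∧ rneZ 9 1027 = 1028 ∧ rneZ 9 1029 = 1028 ∧ rneZ 12 8193 = 8192 := by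
  decide +kernel

end MiniFloat

end Literature.ComputerArithmetic.FloatingPoint
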